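import Literature.MathematicalPhysics.KineticTheory.TaggedSphereSpectralGap

/-!
# Operator step for the crux `SpectralContractionR` (line `Sketch`): numerical radius `½` ⇒ norm `½`

Registered stub `stub_normSqLeQuarter` of the skeleton
`Cruxes.SpectralContractionR.SwapSymmetrisation`: for a bounded self-adjoint operator `T` on a real
inner product space with `⟪T x, e⟫ = ⟪x, e⟫` and `|⟪T x, x⟫| ≤ ½‖x‖²` on `e^⊥`, one has
`‖T x‖² ≤ ¼‖x‖²` on `e^⊥`. Pure inner-product-space algebra (polarisation at `x ± 2 • T x`).
-/

noncomputable section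
open MeasureTheory Metric Real Set Filter Topology
open scoped InnerProductSpace ENNReal
namespace Summit.AtomisticToContinuum.HydrodynamicLimit.Theorems.SpectralContractionRLine.NormSq

/-- OPERATOR STEP (numerical radius `½` on `e^⊥` ⇒ norm `½` on `e^⊥`). For a bounded self-adjoint
`T` on a real inner product space with `⟪T x, e⟫ = ⟪x, e⟫` and `|⟪T x, x⟫| ≤ ½‖x‖²` on `e^⊥`:
`‖T x‖² ≤ ¼‖x‖²` on `e^⊥`. Proof: `y = T x ∈ e^⊥`, so `x ± 2 • y ∈ e^⊥`; subtracting the two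
numerical-radius bounds, `⟪T(x+2y), x+2y⟫ - ⟪T(x-2y), x-2y⟫ = 8‖y‖² ≤ ½(‖x+2y‖² + ‖x-2y‖²)
= ‖x‖² + 4‖y‖²` (the `⟪T x, x⟫`, `⟪T y, y⟫` and `⟪x, y⟫` terms cancel, and `⟪T y, x⟫ = ⟪y, T x⟫
= ‖y‖²` by symmetry). [folklore] -/
theorem stub_normSqLeQuarter : ∀ (H : Type) [NormedAddCommGroup H] [InnerProductSpace ℝ H]
    (T : H →L[ℝ] H) (e : H),
    (∀ x y : H, ⟪T x, y⟫_ℝ = ⟪x, T y⟫_ℝ) → (∀ x : H, ⟪T x, e⟫_ℝ = ⟪x, e⟫_ℝ) →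
    (∀ x : H, ⟪x, e⟫_ℝ = 0 → |⟪T x, x⟫_ℝ| ≤ (1 / 2) * ‖x‖ ^ 2) →
    ∀ x : H, ⟪x, e⟫_ℝ = 0 → ‖T x‖ ^ 2 ≤ (1 / 4) * ‖x‖ ^ 2 := by
  intro H _ _ T e hsa he hnum x hx
  -- `y := T x` is again orthogonal to `e`
  have hy : ⟪T x, e⟫_ℝ = 0 := by rw [he, hx]
  -- hence so are `x + 2 • y` and `x - 2 • y`
  have hplus : ⟪x + (2 : ℝ) • T x, e⟫_ℝ = 0 := by
    rw [inner_add_left, real_inner_smul_left, hx, hy, mul_zero, add_zero]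
  have hminus : ⟪x - (2 : ℝ) • T x, e⟫_ℝ = 0 := by
    rw [inner_sub_left, real_inner_smul_left, hx, hy, mul_zero, sub_zero]
  -- the two numerical-radius bounds (one-sided halves)
  have h1 := (abs_le.1 (hnum _ hplus)).2
  have h2 := (abs_le.1 (hnum _ hminus)).1
  -- symmetry: `⟪T y, x⟫ = ⟪y, T x⟫ = ‖y‖²`
  have hTyx : ⟪T (T x), x⟫_ℝ = ‖T x‖ ^ 2 := by
    rw [hsa, real_inner_self_eq_norm_sq]
  -- bilinear expansions of the two quadratic forms and the two norms
  have e1 : ⟪T (x + (2 : ℝ) • T x), x + (2 : ℝ) • T x⟫_ℝ =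
      ⟪T x, x⟫_ℝ + 4 * ‖T x‖ ^ 2 + 4 * ⟪T (T x), T x⟫_ℝ := by
    rw [map_add, map_smul, inner_add_left, inner_add_right, inner_add_right,
      real_inner_smul_left, real_inner_smul_left, real_inner_smul_right, real_inner_smul_right,
      hTyx, real_inner_self_eq_norm_sq]
    ring
  have e2 : ⟪T (x - (2 : ℝ) • T x), x - (2 : ℝ) • T x⟫_ℝ =
      ⟪T x, x⟫_ℝ - 4 * ‖T x‖ ^ 2 + 4 * ⟪T (T x), T x⟫_ℝ := by
    rw [map_sub, map_smul, inner_sub_left, inner_sub_right, inner_sub_right,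
      real_inner_smul_left, real_inner_smul_left, real_inner_smul_right, real_inner_smul_right,
      hTyx, real_inner_self_eq_norm_sq]
    ring
  have n1 : ‖x + (2 : ℝ) • T x‖ ^ 2 = ‖x‖ ^ 2 + 4 * ⟪x, T x⟫_ℝ + 4 * ‖T x‖ ^ 2 := by
    rw [norm_add_sq_real, real_inner_smul_right, ← real_inner_self_eq_norm_sq ((2 : ℝ) • T x),
      real_inner_smul_left, real_inner_smul_right, real_inner_self_eq_norm_sq]
    ring
  have n2 : ‖x - (2 : ℝ) • T x‖ ^ 2 = ‖x‖ ^ 2 - 4 * ⟪x, T x⟫_ℝ + 4 * ‖T x‖ ^ 2 := by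
    rw [norm_sub_sq_real, real_inner_smul_right, ← real_inner_self_eq_norm_sq ((2 : ℝ) • T x),
      real_inner_smul_left, real_inner_smul_right, real_inner_self_eq_norm_sq]
    ring
  rw [e1, n1] at h1
  rw [e2, n2] at h2
  linarith

end Summit.AtomisticToContinuum.HydrodynamicLimit.Theorems.SpectralContractionRLine.NormSq

end
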